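import Mathlib.Analysis.SpecialFunctions.Log.Basic
import Mathlib.Analysis.SpecialFunctions.Pow.Real
import Mathlib.Algebra.Order.Floor.Defs
import HarnessLib

/-!
# K2R `RealisedQuasiStaticCellLaw`, line `floquet-bloch`: per-period contraction of a non-increasing energy gives exponential
# decay (helper towards `stub_lowSectorDecay`; `--supports stmt-AnomalousDissipation-20446`)

Summits-side helper file (everything proved; no definitions, no named facts; elementary real analysis). If `E ≥ 0` is
non-increasing on `[0, ∞)` and contracts by a factor `θ ∈ (0, 1]` over every period, `E((p+1)P) ≤ θ E(pP)`, then
`E(t) ≤ θ⁻¹ · exp(-(log θ⁻¹ / P) · t) · E(0)` for all `t ≥ 0` (`exp_decay_of_periodic_contraction`); the window form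
(contraction between two instants `pP ≤ a_p ≤ b_p ≤ (p+1)P` of each period) reduces to it by monotonicity
(`exp_decay_of_window_contraction`). This is §3.6 of STUB-PLAN `stub_lowSectorDecay` («from per-period contraction to the
a.e.-t statement»), to be applied to the coefficient energy of the Galerkin truncations (non-increasing by
`blockEnergy_antitone_of_solution`) with the per-window contraction of `outOfPlane_block_decay` / `inPlane_block_decay` /
`restBlock_decay_slot`.
-/

set_option linter.dupNamespace false

noncomputable section

namespace Summit.AnomalousDissipation.AnomalousDissipation.Theorems.SolenoidalFractalHomogenisation.RealisedQuasiStaticCellLaw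

open Real

/-- Iterating the per-period contraction: `E(pP) ≤ θ^p E(0)`. -/
theorem periodic_contraction_pow {E : ℝ → ℝ} {P θ : ℝ} (hθ0 : 0 ≤ θ)
    (hcontr : ∀ p : ℕ, E ((p + 1 : ℕ) * P) ≤ θ * E (p * P)) :
    ∀ p : ℕ, E (p * P) ≤ θ ^ p * E 0 := by
  intro p
  induction p with
  | zero => simp
  | succ p ih =>
    calc E ((p + 1 : ℕ) * P) ≤ θ * E (p * P) := hcontr p
      _ ≤ θ * (θ ^ p * E 0) := mul_le_mul_of_nonneg_left ih hθ0
      _ = θ ^ (p + 1) * E 0 := by ring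

/-- **Exponential decay from per-period contraction.** Let `E` be non-negative and non-increasing on `[0, ∞)`, `P > 0`,
`0 < θ ≤ 1`, and `E((p+1)P) ≤ θ·E(pP)` for every `p ∈ ℕ`. Then `E(t) ≤ θ⁻¹ · exp(-(log θ⁻¹ / P) · t) · E(0)` for `t ≥ 0`. -/
theorem exp_decay_of_periodic_contraction {E : ℝ → ℝ} {P θ : ℝ} (hP : 0 < P) (hθ0 : 0 < θ) (hθ1 : θ ≤ 1)
    (hE0 : 0 ≤ E 0) (hmono : ∀ s t, 0 ≤ s → s ≤ t → E t ≤ E s)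
    (hcontr : ∀ p : ℕ, E ((p + 1 : ℕ) * P) ≤ θ * E (p * P)) {t : ℝ} (ht : 0 ≤ t) :
    E t ≤ θ⁻¹ * Real.exp (-(Real.log θ⁻¹ / P) * t) * E 0 := by
  set p : ℕ := ⌊t / P⌋₊ with hp
  have hpt : (p : ℝ) * P ≤ t := by
    have h1 : (p : ℝ) ≤ t / P := Nat.floor_le (div_nonneg ht hP.le)
    calc (p : ℝ) * P ≤ t / P * P := mul_le_mul_of_nonneg_right h1 hP.le
      _ = t := div_mul_cancel₀ t hP.ne'
  have htp : t / P < p + 1 := Nat.lt_floor_add_one (t / P)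
  -- `E t ≤ E(pP) ≤ θ^p E 0`
  have h1 : E t ≤ θ ^ p * E 0 :=
    (hmono _ _ (by positivity) hpt).trans (periodic_contraction_pow hθ0.le hcontr p)
  -- `θ^p ≤ θ⁻¹ exp(-(log θ⁻¹/P) t)` since `p ≥ t/P - 1` and `θ ≤ 1`
  have hlog : 0 ≤ Real.log θ⁻¹ := Real.log_nonneg (one_le_inv_iff₀.2 ⟨hθ0, hθ1⟩)
  have h2 : θ ^ p ≤ θ⁻¹ * Real.exp (-(Real.log θ⁻¹ / P) * t) := by
    have e1 : θ ^ p = Real.exp (-(Real.log θ⁻¹) * p) := by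
      rw [Real.log_inv, neg_neg, ← Real.exp_log (pow_pos hθ0 p), Real.log_pow]
      ring_nf
    have e2 : θ⁻¹ * Real.exp (-(Real.log θ⁻¹ / P) * t) = Real.exp (-(Real.log θ⁻¹) * (t / P - 1)) := by
      rw [show θ⁻¹ * Real.exp (-(Real.log θ⁻¹ / P) * t) =
          Real.exp (Real.log θ⁻¹) * Real.exp (-(Real.log θ⁻¹ / P) * t) by rw [Real.exp_log (inv_pos.2 hθ0)],
        ← Real.exp_add]
      congr 1
      field_simp
      ring
    rw [e1, e2, Real.exp_le_exp]
    have h3 : t / P - 1 ≤ p := by linarith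
    nlinarith
  calc E t ≤ θ ^ p * E 0 := h1
    _ ≤ θ⁻¹ * Real.exp (-(Real.log θ⁻¹ / P) * t) * E 0 := mul_le_mul_of_nonneg_right h2 hE0

/-- **Window form**: if `E ≥ 0` is non-increasing on `[0, ∞)` and in every period `p` there are instants
`pP ≤ a_p ≤ b_p ≤ (p+1)P` with `E(b_p) ≤ θ E(a_p)`, then `E(t) ≤ θ⁻¹ exp(-(log θ⁻¹/P) t) E(0)` for `t ≥ 0`. -/
theorem exp_decay_of_window_contraction {E : ℝ → ℝ} {P θ : ℝ} (hP : 0 < P) (hθ0 : 0 < θ) (hθ1 : θ ≤ 1)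
    (hE0 : 0 ≤ E 0) (hmono : ∀ s t, 0 ≤ s → s ≤ t → E t ≤ E s)
    (a b : ℕ → ℝ) (ha : ∀ p : ℕ, (p : ℝ) * P ≤ a p) (hab : ∀ p : ℕ, a p ≤ b p) (hb : ∀ p : ℕ, b p ≤ (p + 1 : ℕ) * P)
    (hcontr : ∀ p : ℕ, E (b p) ≤ θ * E (a p)) {t : ℝ} (ht : 0 ≤ t) :
    E t ≤ θ⁻¹ * Real.exp (-(Real.log θ⁻¹ / P) * t) * E 0 := by
  refine exp_decay_of_periodic_contraction hP hθ0 hθ1 hE0 hmono (fun p => ?_) ht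
  have hp0 : 0 ≤ (p : ℝ) * P := by positivity
  calc E ((p + 1 : ℕ) * P) ≤ E (b p) := hmono _ _ (hp0.trans ((ha p).trans (hab p))) (hb p)
    _ ≤ θ * E (a p) := hcontr p
    _ ≤ θ * E (p * P) := mul_le_mul_of_nonneg_left (hmono _ _ hp0 (ha p)) hθ0.le

end Summit.AnomalousDissipation.AnomalousDissipation.Theorems.SolenoidalFractalHomogenisation.RealisedQuasiStaticCellLaw

end
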